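import Literature.MathematicalPhysics.QuantumLattice.AnisotropicKLSIntegral
import Literature.MathematicalPhysics.QuantumLattice.AnisotropicKLSPairDomination
import Literature.MathematicalPhysics.QuantumLattice.XYOrderIntegralDimProofs
import Literature.MathematicalPhysics.QuantumLattice.XYZGroundStateOrderIntegral
import HarnessLib

/-!
# The anisotropic Kennedy–Lieb–Shastry integral of the layered couplings is below `√2/2`:
# `I_{(1,1,r)} ≤ I_{(1,1)} ≤ √2/4 + (3823/5040)·√2/π < √2/2` for every `0 ≤ r ≤ 2`

Topic `MathematicalPhysics/QuantumLattice`; closes the single hypothesis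
`anisoKlsIntegral K < n√2/2` of `xyAniso_longRangeOrder_ground_of_integral` /
`xyAniso_longRangeOrder_thermal_of_integral` (`AnisotropicKLSIntegral.lean`) for the layered
couplings `K = (1, 1, r)`, `0 < r ≤ 2`, and every spin `n ≥ 1`, analytically:

* `lintegral_anisoKlsIntegrand_layered_le` — Kennedy–Lieb–Shastry's convexity reduction
  ([KLS1988PRL] p. 2584, "`I(ν) ≤ I(2)`") for direction-dependent couplings: integrating the
  pointwise pair domination `anisoKlsIntegrand_layered_le_pairs` (`AnisotropicKLSPairDomination.lean`)
  over `[-π,π]³` and deleting one coordinate per pair (the tree's `setLIntegral_box_comp_succAbove`)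
  gives `∫_{[-π,π]³} F_{(1,1,r)} ≤ 2π ∫_{[-π,π]²} F_{(1,1)}`, i.e. `I_{(1,1,r)} ≤ I_{(1,1)}`
  (`anisoKlsIntegral_layered_le_two`);
* `lintegral_anisoKlsIntegrand_two_le` — the two-dimensional integral of the anisotropic integrand
  `F_{(1,1)}(a,b) = H(½(cos a + cos b))`, `H(y) = y₊√(2/(1-y))`, by the route of the tree's
  `lintegral_klsIntegrand_two_le_sharp` (`XYZGroundStateOrderIntegral.lean`: half-angle
  substitution, exact Jacobian `(1-s²)(1-t²) = cos²(2φ)(1-r²) + sin²(2φ)(1-r²/2)²`, the chord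
  `inv_sqrt_convexComb_le` of `X ↦ X^{-1/2}`, polar coordinates, `∫cos²2φ = ∫sin²2φ = π`): here the
  substituted integrand is `4√2(1-r²)/(r√((1-s²)(1-t²)))`, the radial integrals are
  `∫₀¹ 4√2√(1-r²) dr = √2π` and `∫₀¹ 4√2(1-r²)/(1-r²/2) dr ≤ 4√2 · 3823/5040` (the polynomial
  majorant `2(1-u)/(2-u) ≤ 1 - u/2 - u²/4 - u³/8 - u⁴/16`, from `(2-u)(½ + u/4 + u²/8 + u³/16 + u⁴/32)
  = 1 - u⁵/32 ≤ 1`; the exact value is `2 - √2 log(1+√2) = 0.7535…`), whence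
  `∫_{[-π,π]²} F_{(1,1)} ≤ √2π² + (3823/1260)√2π` and **`I_{(1,1)} ≤ √2/4 + (3823/5040)√2/π =
  0.69502… < √2/2 = 0.70711`** (`anisoKlsIntegral_two_lt`; the crude Jacobian bound
  `(1-s²)(1-t²) ≥ 1-r²` of `lintegral_klsIntegrand_two_le` would give exactly `√2/2` here, so the
  chord carries the whole margin; the true value is `0.69104` [float, certified ball arithmetic,
  pub/hubbard-tc KLS-ANISO-ENGINE2.md]);
* `anisoKlsIntegral_layered_lt` — **`I_{(1,1,r)} < √2/2` for `0 ≤ r ≤ 2`**, and the spin form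
  `I_{(1,1,r)} < n√2/2` for `n ≥ 1` (`anisoKlsIntegral_layered_lt_spin`), the literal hypothesis of
  `xyAniso_longRangeOrder_thermal_of_integral`: the layered quantum XY / hard-core-boson model of
  [KLS1988JSP] §3 has long-range order (ground state on the even tori, and Gibbs states for
  `β ≥ β₀(r)`) for EVERY interlayer coupling `0 < r ≤ 2`, with no numerical input.

No named fact is introduced. Proved; all numerics in the file are rational.

## References

* [KLS1988PRL] T. Kennedy, E. H. Lieb, B. S. Shastry, Phys. Rev. Lett. 61 (1988) 2582–2584,
  p. 2584 (the convexity argument `I(ν) ≤ I(2)`) and eq. (8).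
* [KLS1988JSP] T. Kennedy, E. H. Lieb, B. S. Shastry, J. Stat. Phys. 53 (1988) 1019–1030, §3.
-/

noncomputable section

open MeasureTheory Set Filter
open scoped ENNReal
open Literature.MathematicalPhysics.QuantumLattice Literature.Probability.LatticeModels

namespace Literature.MathematicalPhysics.QuantumLattice

/-! ### Measurability and the Lebesgue-integral form of `I_K` -/

section Prelim

variable {d : ℕ}

/-- The anisotropic KLS integrand is measurable. [folklore] -/
private theorem measurable_anisoKlsIntegrand (K : Fin d → ℝ) : Measurable (anisoKlsIntegrand K) := by
  unfold anisoKlsIntegrand anisoCosSum NVectorAniso.anisoDispersion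
  refine Measurable.mul ?_ (Real.continuous_sqrt.measurable.comp ?_)
  · exact (Finset.measurable_sum _ fun i _ =>
      (Real.measurable_cos.comp (measurable_pi_apply i)).const_mul _).max measurable_const
  · exact measurable_const.div (measurable_const.mul (Finset.measurable_sum _ fun i _ =>
      (measurable_const.sub (Real.measurable_cos.comp (measurable_pi_apply i))).const_mul _))

/-- `I_K` as a Lebesgue integral: `I_K = (2π)^{-d} · toReal ∫⁻_{[-π,π]^d} F_K`. [cite: KLS1988PRL, eq. (8)] -/
theorem anisoKlsIntegral_eq_toReal_lintegral (K : Fin d → ℝ) :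
    anisoKlsIntegral K =
      (∫⁻ p in Set.pi univ (fun _ : Fin d => Icc (-Real.pi) Real.pi),
          ENNReal.ofReal (anisoKlsIntegrand K p)).toReal / (2 * Real.pi) ^ d := by
  rw [anisoKlsIntegral, brillouin, integral_eq_lintegral_of_nonneg_ae
    (Eventually.of_forall (anisoKlsIntegrand_nonneg K))
    (measurable_anisoKlsIntegrand K).aestronglyMeasurable]

end Prelim

/-! ### The two-dimensional integral of `F_{(1,1)} = H(½(cos a + cos b))` -/

section TwoDim

/-- **The pointwise majorant after the half-angle substitution.** For `0 < s² + t² = u < 1` and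
`y = 1 - s² - t²`, `4 y √(2/(1-y)) / (√(1-s²)√(1-t²)) ≤ 4(1-u)√2/√u · (w₁/√(1-u) + w₂/(1-u/2))`,
`w₂ = 4s²t²/u²`, `w₁ = 1 - w₂` (`(1-s²)(1-t²) = w₁(1-u) + w₂(1-u/2)²` and the chord
`inv_sqrt_convexComb_le`). [cite: KLS1988PRL, eq. (8)] -/
theorem klsH_substituted_integrand_le {s t : ℝ} (h0 : 0 < s ^ 2 + t ^ 2) (h1 : s ^ 2 + t ^ 2 < 1) :
    4 * ((1 - s ^ 2 - t ^ 2) * Real.sqrt (2 / (1 - (1 - s ^ 2 - t ^ 2)))) /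
        (Real.sqrt (1 - s ^ 2) * Real.sqrt (1 - t ^ 2)) ≤
      4 * (1 - (s ^ 2 + t ^ 2)) * Real.sqrt 2 / Real.sqrt (s ^ 2 + t ^ 2) *
        ((1 - 4 * (s ^ 2 * t ^ 2) / (s ^ 2 + t ^ 2) ^ 2) / Real.sqrt (1 - (s ^ 2 + t ^ 2)) +
          (4 * (s ^ 2 * t ^ 2) / (s ^ 2 + t ^ 2) ^ 2) / (1 - (s ^ 2 + t ^ 2) / 2)) := by
  set u := s ^ 2 + t ^ 2 with hu
  set w₂ : ℝ := 4 * (s ^ 2 * t ^ 2) / u ^ 2 with hw₂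
  have hs2 : s ^ 2 < 1 := by nlinarith [sq_nonneg t]
  have ht2 : t ^ 2 < 1 := by nlinarith [sq_nonneg s]
  have hw₂0 : 0 ≤ w₂ := by positivity
  have hw₂1 : w₂ ≤ 1 := by
    rw [hw₂, div_le_one (by positivity), hu]
    nlinarith [sq_nonneg (s ^ 2 - t ^ 2)]
  have hw₁0 : 0 ≤ 1 - w₂ := sub_nonneg.2 hw₂1
  have ha : 0 < Real.sqrt (1 - u) := Real.sqrt_pos.2 (by linarith)
  have hb : 0 < 1 - u / 2 := by linarith
  have hX : (1 - w₂) * Real.sqrt (1 - u) ^ 2 + w₂ * (1 - u / 2) ^ 2 = (1 - s ^ 2) * (1 - t ^ 2) := by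
    rw [Real.sq_sqrt (by linarith)]
    have hu0 : u ≠ 0 := h0.ne'
    have key : w₂ * u ^ 2 = 4 * (s ^ 2 * t ^ 2) := by
      rw [hw₂]; field_simp
    have : (1 - w₂) * (1 - u) + w₂ * (1 - u / 2) ^ 2 = (1 - u) + w₂ * u ^ 2 / 4 := by ring
    rw [this, key, hu]
    ring
  have hconv := inv_sqrt_convexComb_le ha hb hw₁0 hw₂0 (by ring)
  rw [hX, Real.sqrt_mul (by linarith)] at hconv
  have hC : 4 * ((1 - s ^ 2 - t ^ 2) * Real.sqrt (2 / (1 - (1 - s ^ 2 - t ^ 2)))) =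
      4 * (1 - u) * Real.sqrt 2 / Real.sqrt u := by
    rw [show (1 : ℝ) - s ^ 2 - t ^ 2 = 1 - u by rw [hu]; ring, show (1 : ℝ) - (1 - u) = u by ring,
      Real.sqrt_div' _ h0.le]
    ring
  have hCpos : 0 ≤ 4 * (1 - u) * Real.sqrt 2 / Real.sqrt u := by
    have : 0 ≤ 1 - u := by linarith
    positivity
  rw [hC, div_eq_mul_inv]
  exact mul_le_mul_of_nonneg_left hconv hCpos

/-- The polynomial majorant of the second radial integrand: for `0 ≤ u ≤ 1`,
`2(1-u)/(2-u) ≤ 1 - u/2 - u²/4 - u³/8 - u⁴/16` (`(2-u)·RHS = 2 - 2u + u⁵/16`). [folklore] -/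
private theorem two_mul_one_sub_div_le (u : ℝ) (hu0 : 0 ≤ u) (hu1 : u ≤ 1) :
    2 * (1 - u) / (2 - u) ≤ 1 - u / 2 - u ^ 2 / 4 - u ^ 3 / 8 - u ^ 4 / 16 := by
  rw [div_le_iff₀ (by linarith)]
  nlinarith [pow_nonneg hu0 5, pow_nonneg hu0 4]

/-- `∫₀¹ 4√2 √(1 - r²) dr = √2 π`. [folklore] -/
private theorem integral_radial_one :
    ∫ r in (0 : ℝ)..1, 4 * Real.sqrt 2 * Real.sqrt (1 - r ^ 2) = Real.sqrt 2 * Real.pi := by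
  rw [intervalIntegral.integral_const_mul, integral_sqrt_one_sub_sq_unit]
  ring

/-- `∫₀¹ 4√2 (1 - r²/2 - r⁴/4 - r⁶/8 - r⁸/16) dr = 4√2 · 3823/5040`. [folklore] -/
private theorem integral_radial_two :
    ∫ r in (0 : ℝ)..1, 4 * Real.sqrt 2 * (1 - r ^ 2 / 2 - (r ^ 2) ^ 2 / 4 - (r ^ 2) ^ 3 / 8 -
      (r ^ 2) ^ 4 / 16) = 4 * Real.sqrt 2 * (3823 / 5040) := by
  rw [intervalIntegral.integral_const_mul]
  congr 1
  have e : ∀ r : ℝ, 1 - r ^ 2 / 2 - (r ^ 2) ^ 2 / 4 - (r ^ 2) ^ 3 / 8 - (r ^ 2) ^ 4 / 16 =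
      1 - (1 / 2) * r ^ 2 - (1 / 4) * r ^ 4 - (1 / 8) * r ^ 6 - (1 / 16) * r ^ 8 := fun r => by ring
  simp_rw [e]
  rw [intervalIntegral.integral_sub, intervalIntegral.integral_sub, intervalIntegral.integral_sub,
    intervalIntegral.integral_sub, intervalIntegral.integral_const, intervalIntegral.integral_const_mul,
    intervalIntegral.integral_const_mul, intervalIntegral.integral_const_mul,
    intervalIntegral.integral_const_mul, integral_pow, integral_pow, integral_pow, integral_pow]
  · norm_num
  all_goals
    apply_rules [intervalIntegrable_const, IntervalIntegrable.sub, IntervalIntegrable.const_mul,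
      intervalIntegral.intervalIntegrable_pow]

/-- **The two-dimensional integral of the anisotropic integrand**:
`∫_{[-π,π]²} F_{(1,1)} ≤ √2π² + 4√2·(3823/5040)·π` (as a Lebesgue integral). Route of the tree's
`lintegral_klsIntegrand_two_le_sharp` (half-angle substitution, change of variables, the chord
majorant `klsH_substituted_integrand_le`, polar coordinates, `∫cos²2φ = ∫sin²2φ = π`), with the
radial integrals `∫₀¹ 4√2√(1-r²) = √2π` and `∫₀¹ 4√2(1-r²)/(1-r²/2) ≤ 4√2·3823/5040`.
[cite: KLS1988PRL, eq. (8)] -/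
theorem lintegral_anisoKlsIntegrand_two_le :
    ∫⁻ p in Set.pi univ (fun _ : Fin 2 => Icc (-Real.pi) Real.pi),
        ENNReal.ofReal (anisoKlsIntegrand ![(1 : ℝ), 1] p)
      ≤ ENNReal.ofReal (Real.sqrt 2 * Real.pi ^ 2 + 4 * Real.sqrt 2 * (3823 / 5040) * Real.pi) := by
  -- (a) closed box → open box
  have hae : (Set.pi univ fun _ : Fin 2 => Ioo (-Real.pi) Real.pi) =ᵐ[volume]
      (Set.pi univ fun _ : Fin 2 => Icc (-Real.pi) Real.pi) := by
    have h := Measure.pi_Ioo_ae_eq_pi_Icc (μ := fun _ : Fin 2 => (volume : Measure ℝ)) (s := univ)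
      (f := fun _ => -Real.pi) (g := fun _ => Real.pi)
    rw [← volume_pi] at h
    exact h
  rw [← setLIntegral_congr hae]
  -- (b) transport to `ℝ × ℝ`
  set S₂ : Set (ℝ × ℝ) := Ioo (-Real.pi) Real.pi ×ˢ Ioo (-Real.pi) Real.pi with hS₂
  have hS₂m : MeasurableSet S₂ := measurableSet_Ioo.prod measurableSet_Ioo
  set Φ : ℝ × ℝ → ℝ≥0∞ := fun q => ENNReal.ofReal (anisoKlsIntegrand ![(1 : ℝ), 1] ![q.1, q.2]) with hΦ
  have hpre : (MeasurableEquiv.finTwoArrow : (Fin 2 → ℝ) ≃ᵐ ℝ × ℝ) ⁻¹' S₂ =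
      Set.pi univ fun _ : Fin 2 => Ioo (-Real.pi) Real.pi := by
    ext v
    simp [hS₂, MeasurableEquiv.finTwoArrow_apply, Fin.forall_fin_two]
  have hb : ∫⁻ v in Set.pi univ (fun _ : Fin 2 => Ioo (-Real.pi) Real.pi),
      ENNReal.ofReal (anisoKlsIntegrand ![(1 : ℝ), 1] v) = ∫⁻ q in S₂, Φ q := by
    rw [← hpre, ← (volume_preserving_finTwoArrow ℝ).setLIntegral_comp_preimage_emb
      (MeasurableEquiv.finTwoArrow).measurableEmbedding Φ S₂]
    refine lintegral_congr fun v => ?_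
    simp only [hΦ, MeasurableEquiv.finTwoArrow_apply]
    congr 2
    ext i
    fin_cases i <;> rfl
  rw [hb]
  -- (c) change of variables on `S₂`
  set ψ : ℝ × ℝ → ℝ × ℝ := fun q => (Real.sin (q.1 / 2), Real.sin (q.2 / 2)) with hψ
  set ψ' : ℝ × ℝ → (ℝ × ℝ →L[ℝ] ℝ × ℝ) := fun q =>
    (ContinuousLinearMap.toSpanSingleton ℝ (Real.cos (q.1 / 2) / 2)).prodMap
      (ContinuousLinearMap.toSpanSingleton ℝ (Real.cos (q.2 / 2) / 2)) with hψ'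
  have hderiv : ∀ q ∈ S₂, HasFDerivWithinAt ψ (ψ' q) S₂ q := fun q _ =>
    (HasFDerivAt.prodMap (p := q) (hasDerivAt_sin_half q.1).hasFDerivAt
      (hasDerivAt_sin_half q.2).hasFDerivAt).hasFDerivWithinAt
  have hinj : InjOn ψ S₂ := injOn_sin_half.prodMap injOn_sin_half
  set g : ℝ × ℝ → ℝ≥0∞ := fun w => ENNReal.ofReal (4 * (max (1 - w.1 ^ 2 - w.2 ^ 2) 0 *
    Real.sqrt (2 / (1 - (1 - w.1 ^ 2 - w.2 ^ 2)))) /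
      (Real.sqrt (1 - w.1 ^ 2) * Real.sqrt (1 - w.2 ^ 2))) with hg
  have hpt : EqOn Φ (fun q => ENNReal.ofReal |(ψ' q).det| * g (ψ q)) S₂ := by
    rintro ⟨a, b⟩ ⟨ha, hb⟩
    have hca : 0 < Real.cos (a / 2) := Real.cos_pos_of_mem_Ioo ⟨by linarith [ha.1], by linarith [ha.2]⟩
    have hcb : 0 < Real.cos (b / 2) := Real.cos_pos_of_mem_Ioo ⟨by linarith [hb.1], by linarith [hb.2]⟩
    have hsa : Real.sqrt (1 - Real.sin (a / 2) ^ 2) = Real.cos (a / 2) :=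
      (Real.cos_eq_sqrt_one_sub_sin_sq (by linarith [ha.1]) (by linarith [ha.2])).symm
    have hsb : Real.sqrt (1 - Real.sin (b / 2) ^ 2) = Real.cos (b / 2) :=
      (Real.cos_eq_sqrt_one_sub_sin_sq (by linarith [hb.1]) (by linarith [hb.2])).symm
    simp only [hΦ, hg, hψ, hψ', det_toSpanSingleton_prodMap]
    rw [anisoKlsIntegrand_two_eq_klsH, half_cos_add_cos_eq, hsa, hsb,
      abs_of_pos (mul_pos (half_pos hca) (half_pos hcb)), ← ENNReal.ofReal_mul (by positivity)]
    congr 1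
    field_simp
    ring
  have hc : ∫⁻ q in S₂, Φ q = ∫⁻ w in ψ '' S₂, g w := by
    rw [lintegral_image_eq_lintegral_abs_det_fderiv_mul volume hS₂m hderiv hinj g]
    exact setLIntegral_congr_fun hS₂m hpt
  rw [hc]
  refine (setLIntegral_le_lintegral _ _).trans ?_
  -- (d) the chord majorant
  set h : ℝ × ℝ → ℝ≥0∞ := fun w => ENNReal.ofReal (if 0 < w.1 ^ 2 + w.2 ^ 2 ∧ w.1 ^ 2 + w.2 ^ 2 < 1 then
    4 * (1 - (w.1 ^ 2 + w.2 ^ 2)) * Real.sqrt 2 / Real.sqrt (w.1 ^ 2 + w.2 ^ 2) *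
      ((1 - 4 * (w.1 ^ 2 * w.2 ^ 2) / (w.1 ^ 2 + w.2 ^ 2) ^ 2) / Real.sqrt (1 - (w.1 ^ 2 + w.2 ^ 2)) +
        (4 * (w.1 ^ 2 * w.2 ^ 2) / (w.1 ^ 2 + w.2 ^ 2) ^ 2) / (1 - (w.1 ^ 2 + w.2 ^ 2) / 2))
    else 0) with hh
  have hgh : g ≤ h := by
    rintro ⟨s, t⟩
    simp only [hg, hh]
    by_cases hlt : s ^ 2 + t ^ 2 < 1
    · rcases (show 0 ≤ s ^ 2 + t ^ 2 by positivity).eq_or_lt with h0 | h0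
      · -- the origin: both sides are (junk) `0`
        have hs : s = 0 := by nlinarith [sq_nonneg s, sq_nonneg t]
        have ht : t = 0 := by nlinarith [sq_nonneg s, sq_nonneg t]
        subst hs; subst ht
        norm_num
      · rw [if_pos ⟨h0, hlt⟩, max_eq_left (by linarith)]
        exact ENNReal.ofReal_le_ofReal (klsH_substituted_integrand_le h0 hlt)
    · rw [max_eq_right (by linarith), if_neg (fun h' => hlt h'.2), ENNReal.ofReal_zero]
      simp
  refine (lintegral_mono hgh).trans ?_
  -- (e) polar coordinates: `r • h = φ₁(r) cos²(2θ) + φ₂(r) sin²(2θ)` on `0 < r < 1`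
  rw [← lintegral_comp_polarCoord_symm h]
  set φ₁ : ℝ → ℝ≥0∞ := fun r => ENNReal.ofReal
    (4 * (1 - r ^ 2) * Real.sqrt 2 / Real.sqrt (1 - r ^ 2)) with hφ₁
  set φ₂ : ℝ → ℝ≥0∞ := fun r => ENNReal.ofReal
    (4 * (1 - r ^ 2) * Real.sqrt 2 / (1 - r ^ 2 / 2)) with hφ₂
  set Θ₁ : ℝ → ℝ≥0∞ := fun θ => ENNReal.ofReal (Real.cos (2 * θ) ^ 2) with hΘ₁
  set Θ₂ : ℝ → ℝ≥0∞ := fun θ => ENNReal.ofReal (Real.sin (2 * θ) ^ 2) with hΘ₂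
  have hpolar : EqOn (fun p : ℝ × ℝ => ENNReal.ofReal p.1 • h (polarCoord.symm p))
      (fun p => (Ioo (0 : ℝ) 1).indicator φ₁ p.1 * Θ₁ p.2 + (Ioo (0 : ℝ) 1).indicator φ₂ p.1 * Θ₂ p.2)
      polarCoord.target := by
    rintro ⟨r, θ⟩ ⟨hr, -⟩
    simp only [Set.mem_Ioi] at hr
    have hr2 : (r * Real.cos θ) ^ 2 + (r * Real.sin θ) ^ 2 = r ^ 2 := by
      nlinarith [Real.sin_sq_add_cos_sq θ]
    simp only [hh, polarCoord_symm_apply, hr2, smul_eq_mul]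
    by_cases h1 : r < 1
    · have hr01 : r ∈ Set.Ioo (0 : ℝ) 1 := ⟨hr, h1⟩
      have hrr : 0 < r ^ 2 := by positivity
      rw [if_pos ⟨hrr, by nlinarith⟩, Set.indicator_of_mem hr01, Set.indicator_of_mem hr01]
      simp only [hφ₁, hφ₂, hΘ₁, hΘ₂]
      have hw : 4 * ((r * Real.cos θ) ^ 2 * (r * Real.sin θ) ^ 2) / (r ^ 2) ^ 2 = Real.sin (2 * θ) ^ 2 := by
        rw [Real.sin_two_mul]
        field_simp
        ring
      have hw' : 1 - Real.sin (2 * θ) ^ 2 = Real.cos (2 * θ) ^ 2 := by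
        nlinarith [Real.sin_sq_add_cos_sq (2 * θ)]
      rw [hw, hw', Real.sqrt_sq hr.le]
      have hA : 0 ≤ 4 * (1 - r ^ 2) * Real.sqrt 2 := by
        have : 0 ≤ 1 - r ^ 2 := by nlinarith
        positivity
      have hs1 : 0 ≤ Real.sqrt (1 - r ^ 2) := Real.sqrt_nonneg _
      have hb2 : 0 < 1 - r ^ 2 / 2 := by nlinarith
      have e1 : ENNReal.ofReal (4 * (1 - r ^ 2) * Real.sqrt 2 / Real.sqrt (1 - r ^ 2)) *
          ENNReal.ofReal (Real.cos (2 * θ) ^ 2) =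
          ENNReal.ofReal (4 * (1 - r ^ 2) * Real.sqrt 2 / Real.sqrt (1 - r ^ 2) *
            Real.cos (2 * θ) ^ 2) := (ENNReal.ofReal_mul (by positivity)).symm
      have e2 : ENNReal.ofReal (4 * (1 - r ^ 2) * Real.sqrt 2 / (1 - r ^ 2 / 2)) *
          ENNReal.ofReal (Real.sin (2 * θ) ^ 2) =
          ENNReal.ofReal (4 * (1 - r ^ 2) * Real.sqrt 2 / (1 - r ^ 2 / 2) *
            Real.sin (2 * θ) ^ 2) := (ENNReal.ofReal_mul (by positivity)).symm
      rw [e1, e2, ← ENNReal.ofReal_add (by positivity) (by positivity)]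
      try rw [← ENNReal.ofReal_mul hr.le]
      congr 1
      field_simp
    · rw [if_neg (fun h' => h1 (by nlinarith [h'.2])), Set.indicator_of_notMem (show r ∉ Set.Ioo (0 : ℝ) 1 from
        fun h => h1 h.2), Set.indicator_of_notMem (show r ∉ Set.Ioo (0 : ℝ) 1 from fun h => h1 h.2),
        ENNReal.ofReal_zero, mul_zero, zero_mul, zero_mul, add_zero]
  rw [setLIntegral_congr_fun polarCoord.open_target.measurableSet hpolar]
  -- (f) the product integrals
  have hφ₁m : Measurable φ₁ := by rw [hφ₁]; exact ENNReal.measurable_ofReal.comp (by fun_prop)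
  have hφ₂m : Measurable φ₂ := by rw [hφ₂]; exact ENNReal.measurable_ofReal.comp (by fun_prop)
  have hΘ₁m : Measurable Θ₁ := by rw [hΘ₁]; exact ENNReal.measurable_ofReal.comp (by fun_prop)
  have hΘ₂m : Measurable Θ₂ := by rw [hΘ₂]; exact ENNReal.measurable_ofReal.comp (by fun_prop)
  have hF₁m : Measurable fun p : ℝ × ℝ => (Ioo (0 : ℝ) 1).indicator φ₁ p.1 * Θ₁ p.2 :=
    ((hφ₁m.indicator measurableSet_Ioo).comp measurable_fst).mul (hΘ₁m.comp measurable_snd)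
  rw [show polarCoord.target = Ioi (0 : ℝ) ×ˢ Ioo (-Real.pi) Real.pi from rfl,
    Measure.volume_eq_prod, ← Measure.prod_restrict, lintegral_add_left hF₁m,
    lintegral_prod_mul ((hφ₁m.indicator measurableSet_Ioo).aemeasurable) hΘ₁m.aemeasurable,
    lintegral_prod_mul ((hφ₂m.indicator measurableSet_Ioo).aemeasurable) hΘ₂m.aemeasurable,
    lintegral_indicator measurableSet_Ioo, lintegral_indicator measurableSet_Ioo,
    Measure.restrict_restrict measurableSet_Ioo, Set.inter_eq_left.2 Set.Ioo_subset_Ioi_self]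
  -- the angular integrals
  have hΘ₁i : ∫⁻ θ in Ioo (-Real.pi) Real.pi, Θ₁ θ = ENNReal.ofReal Real.pi := by
    rw [hΘ₁, lintegral_Ioo_eq_ofReal_intervalIntegral (by fun_prop) (fun x => sq_nonneg _)
      (by linarith [Real.pi_pos]), integral_cos_two_mul_sq]
  have hΘ₂i : ∫⁻ θ in Ioo (-Real.pi) Real.pi, Θ₂ θ = ENNReal.ofReal Real.pi := by
    rw [hΘ₂, lintegral_Ioo_eq_ofReal_intervalIntegral (by fun_prop) (fun x => sq_nonneg _)
      (by linarith [Real.pi_pos]), integral_sin_two_mul_sq]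
  -- the radial integrals
  have hrad₁ : ∫⁻ r in Ioo (0 : ℝ) 1, φ₁ r ≤ ENNReal.ofReal (Real.sqrt 2 * Real.pi) := by
    have hle : ∀ r ∈ Ioo (0 : ℝ) 1, φ₁ r ≤
        ENNReal.ofReal (4 * Real.sqrt 2 * Real.sqrt (1 - r ^ 2)) := by
      intro r hr
      have hr1 : 0 < 1 - r ^ 2 := by nlinarith [hr.1, hr.2]
      have hs : Real.sqrt (1 - r ^ 2) ≠ 0 := (Real.sqrt_pos.2 hr1).ne'
      have hq : (1 - r ^ 2) / Real.sqrt (1 - r ^ 2) = Real.sqrt (1 - r ^ 2) := by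
        rw [div_eq_iff hs, Real.mul_self_sqrt hr1.le]
      rw [hφ₁]
      refine ENNReal.ofReal_le_ofReal (le_of_eq ?_)
      calc 4 * (1 - r ^ 2) * Real.sqrt 2 / Real.sqrt (1 - r ^ 2)
          = 4 * Real.sqrt 2 * ((1 - r ^ 2) / Real.sqrt (1 - r ^ 2)) := by ring
        _ = 4 * Real.sqrt 2 * Real.sqrt (1 - r ^ 2) := by rw [hq]
    have hcont : Continuous fun r : ℝ => 4 * Real.sqrt 2 * Real.sqrt (1 - r ^ 2) := by fun_prop
    calc ∫⁻ r in Ioo (0 : ℝ) 1, φ₁ r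
        ≤ ∫⁻ r in Ioo (0 : ℝ) 1, ENNReal.ofReal (4 * Real.sqrt 2 * Real.sqrt (1 - r ^ 2)) :=
          setLIntegral_mono (ENNReal.measurable_ofReal.comp hcont.measurable) hle
      _ = ENNReal.ofReal (∫ r in (0 : ℝ)..1, 4 * Real.sqrt 2 * Real.sqrt (1 - r ^ 2)) :=
          lintegral_Ioo_eq_ofReal_intervalIntegral hcont (fun r => by positivity) zero_le_one
      _ = ENNReal.ofReal (Real.sqrt 2 * Real.pi) := by rw [integral_radial_one]
  have hrad₂ : ∫⁻ r in Ioo (0 : ℝ) 1, φ₂ r ≤ ENNReal.ofReal (4 * Real.sqrt 2 * (3823 / 5040)) := by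
    have hle : ∀ r ∈ Ioo (0 : ℝ) 1, φ₂ r ≤ ENNReal.ofReal (4 * Real.sqrt 2 *
        (1 - r ^ 2 / 2 - (r ^ 2) ^ 2 / 4 - (r ^ 2) ^ 3 / 8 - (r ^ 2) ^ 4 / 16)) := by
      intro r hr
      have hr0 : 0 ≤ r ^ 2 := sq_nonneg r
      have hr1 : r ^ 2 ≤ 1 := by nlinarith [hr.1, hr.2]
      have hb : 0 < 1 - r ^ 2 / 2 := by nlinarith
      rw [hφ₂]
      refine ENNReal.ofReal_le_ofReal ?_
      have hpoly := two_mul_one_sub_div_le (r ^ 2) hr0 hr1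
      have e : 4 * (1 - r ^ 2) * Real.sqrt 2 / (1 - r ^ 2 / 2) =
          4 * Real.sqrt 2 * (2 * (1 - r ^ 2) / (2 - r ^ 2)) := by
        have h2 : (2 : ℝ) - r ^ 2 ≠ 0 := by nlinarith
        field_simp
      rw [e]
      exact mul_le_mul_of_nonneg_left hpoly (by positivity)
    have hcont : Continuous fun r : ℝ => 4 * Real.sqrt 2 *
        (1 - r ^ 2 / 2 - (r ^ 2) ^ 2 / 4 - (r ^ 2) ^ 3 / 8 - (r ^ 2) ^ 4 / 16) := by fun_prop
    calc ∫⁻ r in Ioo (0 : ℝ) 1, φ₂ r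
        ≤ ∫⁻ r in Ioo (0 : ℝ) 1, ENNReal.ofReal (4 * Real.sqrt 2 *
            (1 - r ^ 2 / 2 - (r ^ 2) ^ 2 / 4 - (r ^ 2) ^ 3 / 8 - (r ^ 2) ^ 4 / 16)) :=
          setLIntegral_mono (ENNReal.measurable_ofReal.comp hcont.measurable) hle
      _ ≤ ∫⁻ r in Ioo (0 : ℝ) 1, ENNReal.ofReal (max (4 * Real.sqrt 2 *
            (1 - r ^ 2 / 2 - (r ^ 2) ^ 2 / 4 - (r ^ 2) ^ 3 / 8 - (r ^ 2) ^ 4 / 16)) 0) :=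
          lintegral_mono fun r => ENNReal.ofReal_le_ofReal (le_max_left _ _)
      _ = ENNReal.ofReal (∫ r in (0 : ℝ)..1, max (4 * Real.sqrt 2 *
            (1 - r ^ 2 / 2 - (r ^ 2) ^ 2 / 4 - (r ^ 2) ^ 3 / 8 - (r ^ 2) ^ 4 / 16)) 0) :=
          lintegral_Ioo_eq_ofReal_intervalIntegral (hcont.max continuous_const)
            (fun r => le_max_right _ _) zero_le_one
      _ = ENNReal.ofReal (4 * Real.sqrt 2 * (3823 / 5040)) := by
          rw [← integral_radial_two]
          congr 1
          refine intervalIntegral.integral_congr fun r hr => ?_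
          rw [uIcc_of_le zero_le_one] at hr
          refine max_eq_left (mul_nonneg (by positivity) ?_)
          have hr0 : 0 ≤ r ^ 2 := sq_nonneg r
          have hr1 : r ^ 2 ≤ 1 := by nlinarith [hr.1, hr.2]
          nlinarith [pow_nonneg hr0 2, pow_nonneg hr0 3, pow_nonneg hr0 4,
            pow_le_one₀ hr0 hr1 (n := 2), pow_le_one₀ hr0 hr1 (n := 3), pow_le_one₀ hr0 hr1 (n := 4)]
  -- assembly
  rw [hΘ₁i, hΘ₂i]
  calc (∫⁻ r in Ioo (0 : ℝ) 1, φ₁ r) * ENNReal.ofReal Real.pi +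
        (∫⁻ r in Ioo (0 : ℝ) 1, φ₂ r) * ENNReal.ofReal Real.pi
      ≤ ENNReal.ofReal (Real.sqrt 2 * Real.pi) * ENNReal.ofReal Real.pi +
          ENNReal.ofReal (4 * Real.sqrt 2 * (3823 / 5040)) * ENNReal.ofReal Real.pi := by gcongr
    _ = ENNReal.ofReal (Real.sqrt 2 * Real.pi ^ 2 + 4 * Real.sqrt 2 * (3823 / 5040) * Real.pi) := by
        rw [← ENNReal.ofReal_mul (by positivity), ← ENNReal.ofReal_mul (by positivity),
          ← ENNReal.ofReal_add (by positivity) (by positivity)]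
        congr 1
        ring

/-- **`I_{(1,1)} ≤ √2/4 + (3823/5040)√2/π`** (`= 0.69502…`; true value `0.69104`).
[cite: KLS1988PRL, eq. (8)] -/
theorem anisoKlsIntegral_two_le :
    anisoKlsIntegral ![(1 : ℝ), 1] ≤ Real.sqrt 2 / 4 + 3823 / 5040 * Real.sqrt 2 / Real.pi := by
  rw [anisoKlsIntegral_eq_toReal_lintegral]
  have htr := ENNReal.toReal_le_of_le_ofReal (by positivity) lintegral_anisoKlsIntegrand_two_le
  have hπ : (0 : ℝ) < (2 * Real.pi) ^ 2 := by positivity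
  refine (div_le_div_of_nonneg_right htr hπ.le).trans (le_of_eq ?_)
  field_simp
  ring

/-- **`I_{(1,1)} < √2/2`** (`0.69502 < 0.70711`; the inequality is `3823/5040 < π/4`).
[cite: KLS1988PRL, eq. (8)] -/
theorem anisoKlsIntegral_two_lt : anisoKlsIntegral ![(1 : ℝ), 1] < Real.sqrt 2 / 2 := by
  refine anisoKlsIntegral_two_le.trans_lt ?_
  have hs : 0 < Real.sqrt 2 := Real.sqrt_pos.2 (by norm_num)
  have hπ : (3823 : ℝ) / 5040 / Real.pi < 1 / 4 := by
    rw [div_lt_iff₀ Real.pi_pos]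
    nlinarith [Real.pi_gt_d2]
  have e : (3823 : ℝ) / 5040 * Real.sqrt 2 / Real.pi = Real.sqrt 2 * (3823 / 5040 / Real.pi) := by
    ring
  have h := mul_lt_mul_of_pos_left hπ hs
  rw [e]
  linarith

end TwoDim

/-! ### The convexity reduction `I_{(1,1,r)} ≤ I_{(1,1)}` and the layered theorem -/

section Layered

/-- The pair integrand is nonnegative. [folklore] -/
private theorem klsH_pair_nonneg (a b : ℝ) :
    0 ≤ max ((Real.cos a + Real.cos b) / 2) 0 * Real.sqrt (2 / (1 - (Real.cos a + Real.cos b) / 2)) :=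
  mul_nonneg (le_max_right _ _) (Real.sqrt_nonneg _)

/-- The three coordinate deletions on `Fin 3`, as pairs. [folklore] -/
private theorem succAbove_pairs (p : Fin 3 → ℝ) :
    (fun j : Fin 2 => p ((2 : Fin 3).succAbove j)) = ![p 0, p 1] ∧
      (fun j : Fin 2 => p ((1 : Fin 3).succAbove j)) = ![p 0, p 2] ∧
        (fun j : Fin 2 => p ((0 : Fin 3).succAbove j)) = ![p 1, p 2] := by
  refine ⟨?_, ?_, ?_⟩ <;> funext j <;> fin_cases j <;> rfl

/-- **The convexity reduction as an inequality of Lebesgue integrals**: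
`∫_{[-π,π]³} F_{(1,1,r)} ≤ 2π ∫_{[-π,π]²} F_{(1,1)}` for `0 ≤ r ≤ 2` (the pair domination a.e.,
then Tonelli at each deleted coordinate; the weights `(2-r)/(2+r) + 2·r/(2+r) = 1`).
[cite: KLS1988PRL, after eq. (8)] -/
theorem lintegral_anisoKlsIntegrand_layered_le {r : ℝ} (hr0 : 0 ≤ r) (hr2 : r ≤ 2) :
    ∫⁻ p in Set.pi univ (fun _ : Fin 3 => Icc (-Real.pi) Real.pi),
        ENNReal.ofReal (anisoKlsIntegrand ![(1 : ℝ), 1, r] p) ≤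
      ENNReal.ofReal (2 * Real.pi) *
        ∫⁻ q in Set.pi univ (fun _ : Fin 2 => Icc (-Real.pi) Real.pi),
          ENNReal.ofReal (anisoKlsIntegrand ![(1 : ℝ), 1] q) := by
  set f₂ : (Fin 2 → ℝ) → ℝ≥0∞ := fun q => ENNReal.ofReal (anisoKlsIntegrand ![(1 : ℝ), 1] q) with hf₂
  have hf₂m : Measurable f₂ := ENNReal.measurable_ofReal.comp (measurable_anisoKlsIntegrand _)
  set l12 : ℝ := (2 - r) / (2 + r) with hl12
  set l : ℝ := r / (2 + r) with hl
  have h2r : 0 < 2 + r := by linarith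
  have hl12n : 0 ≤ l12 := div_nonneg (by linarith) h2r.le
  have hln : 0 ≤ l := div_nonneg hr0 h2r.le
  have hsum : l12 + l + l = 1 := by rw [hl12, hl]; field_simp; ring
  have hmeas : ∀ k : Fin 3, Measurable fun p : Fin 3 → ℝ => f₂ (fun j => p (k.succAbove j)) :=
    fun k => hf₂m.comp (measurable_pi_lambda _ fun j => measurable_pi_apply _)
  have hae := ae_restrict_of_ae (s := Set.pi univ (fun _ : Fin 3 => Icc (-Real.pi) Real.pi))
    (ae_forall_cos_apply_lt_one 3)
  -- the two-dimensional integrand on a pair of coordinates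
  have hpair : ∀ a b : ℝ, ENNReal.ofReal (max ((Real.cos a + Real.cos b) / 2) 0 *
      Real.sqrt (2 / (1 - (Real.cos a + Real.cos b) / 2))) = f₂ ![a, b] := by
    intro a b
    rw [hf₂]
    simp only
    rw [anisoKlsIntegrand_two_eq_klsH]
  calc ∫⁻ p in Set.pi univ (fun _ : Fin 3 => Icc (-Real.pi) Real.pi),
        ENNReal.ofReal (anisoKlsIntegrand ![(1 : ℝ), 1, r] p)
      ≤ ∫⁻ p in Set.pi univ (fun _ : Fin 3 => Icc (-Real.pi) Real.pi),
          (ENNReal.ofReal l12 * f₂ (fun j => p ((2 : Fin 3).succAbove j)) +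
            ENNReal.ofReal l * f₂ (fun j => p ((1 : Fin 3).succAbove j)) +
            ENNReal.ofReal l * f₂ (fun j => p ((0 : Fin 3).succAbove j))) := by
        refine lintegral_mono_ae (hae.mono fun p hp => ?_)
        have hp2 : ∀ i j : Fin 3, i ≠ j → Real.cos (p i) + Real.cos (p j) < 2 :=
          fun i j _ => by linarith [hp i, hp j]
        refine (ENNReal.ofReal_le_ofReal (anisoKlsIntegrand_layered_le_pairs hr0 hr2 p hp2)).trans
          (le_of_eq ?_)
        rw [ENNReal.ofReal_add (add_nonneg (mul_nonneg hl12n (klsH_pair_nonneg _ _))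
            (mul_nonneg hln (klsH_pair_nonneg _ _))) (mul_nonneg hln (klsH_pair_nonneg _ _)),
          ENNReal.ofReal_add (mul_nonneg hl12n (klsH_pair_nonneg _ _)) (mul_nonneg hln (klsH_pair_nonneg _ _)),
          ENNReal.ofReal_mul hl12n, ENNReal.ofReal_mul hln, ENNReal.ofReal_mul hln,
          hpair, hpair, hpair, (succAbove_pairs p).1, (succAbove_pairs p).2.1,
          (succAbove_pairs p).2.2]
    _ = ENNReal.ofReal l12 * (∫⁻ p in Set.pi univ (fun _ : Fin 3 => Icc (-Real.pi) Real.pi),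
            f₂ (fun j => p ((2 : Fin 3).succAbove j))) +
          ENNReal.ofReal l * (∫⁻ p in Set.pi univ (fun _ : Fin 3 => Icc (-Real.pi) Real.pi),
            f₂ (fun j => p ((1 : Fin 3).succAbove j))) +
          ENNReal.ofReal l * (∫⁻ p in Set.pi univ (fun _ : Fin 3 => Icc (-Real.pi) Real.pi),
            f₂ (fun j => p ((0 : Fin 3).succAbove j))) := by
        rw [lintegral_add_right _ ((hmeas 0).const_mul _), lintegral_add_right _ ((hmeas 1).const_mul _),
          lintegral_const_mul _ (hmeas 2), lintegral_const_mul _ (hmeas 1), lintegral_const_mul _ (hmeas 0)]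
    _ = (ENNReal.ofReal l12 + ENNReal.ofReal l + ENNReal.ofReal l) * (ENNReal.ofReal (2 * Real.pi) *
          ∫⁻ q in Set.pi univ (fun _ : Fin 2 => Icc (-Real.pi) Real.pi), f₂ q) := by
        have e2 : ∫⁻ p in Set.pi univ (fun _ : Fin 3 => Icc (-Real.pi) Real.pi),
            f₂ (fun j => p ((2 : Fin 3).succAbove j)) = ENNReal.ofReal (2 * Real.pi) *
              ∫⁻ q in Set.pi univ (fun _ : Fin 2 => Icc (-Real.pi) Real.pi), f₂ q :=
          setLIntegral_box_comp_succAbove 2 hf₂m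
        have e1 : ∫⁻ p in Set.pi univ (fun _ : Fin 3 => Icc (-Real.pi) Real.pi),
            f₂ (fun j => p ((1 : Fin 3).succAbove j)) = ENNReal.ofReal (2 * Real.pi) *
              ∫⁻ q in Set.pi univ (fun _ : Fin 2 => Icc (-Real.pi) Real.pi), f₂ q :=
          setLIntegral_box_comp_succAbove 1 hf₂m
        have e0 : ∫⁻ p in Set.pi univ (fun _ : Fin 3 => Icc (-Real.pi) Real.pi),
            f₂ (fun j => p ((0 : Fin 3).succAbove j)) = ENNReal.ofReal (2 * Real.pi) *
              ∫⁻ q in Set.pi univ (fun _ : Fin 2 => Icc (-Real.pi) Real.pi), f₂ q :=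
          setLIntegral_box_comp_succAbove 0 hf₂m
        rw [e2, e1, e0]
        ring
    _ = ENNReal.ofReal (2 * Real.pi) *
          ∫⁻ q in Set.pi univ (fun _ : Fin 2 => Icc (-Real.pi) Real.pi), f₂ q := by
        rw [← ENNReal.ofReal_add hl12n hln, ← ENNReal.ofReal_add (add_nonneg hl12n hln) hln, hsum,
          ENNReal.ofReal_one, one_mul]

/-- **`I_{(1,1,r)} ≤ I_{(1,1)}` for `0 ≤ r ≤ 2`** — Kennedy–Lieb–Shastry's `I(ν) ≤ I(2)` for the
layered couplings. [cite: KLS1988PRL, after eq. (8)] -/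
theorem anisoKlsIntegral_layered_le_two {r : ℝ} (hr0 : 0 ≤ r) (hr2 : r ≤ 2) :
    anisoKlsIntegral ![(1 : ℝ), 1, r] ≤ anisoKlsIntegral ![(1 : ℝ), 1] := by
  rw [anisoKlsIntegral_eq_toReal_lintegral, anisoKlsIntegral_eq_toReal_lintegral]
  have hfin : ∫⁻ q in Set.pi univ (fun _ : Fin 2 => Icc (-Real.pi) Real.pi),
      ENNReal.ofReal (anisoKlsIntegrand ![(1 : ℝ), 1] q) < ∞ :=
    lintegral_anisoKlsIntegrand_two_le.trans_lt ENNReal.ofReal_lt_top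
  have hstep := lintegral_anisoKlsIntegrand_layered_le hr0 hr2
  have h2π : (0 : ℝ) < 2 * Real.pi := by positivity
  have hmono := ENNReal.toReal_mono (ENNReal.mul_ne_top ENNReal.ofReal_ne_top hfin.ne) hstep
  rw [ENNReal.toReal_ofReal_mul _ _ h2π.le] at hmono
  refine (div_le_div_of_nonneg_right hmono (by positivity)).trans (le_of_eq ?_)
  field_simp
  ring

/-- **The layered anisotropic KLS integral is below `√2/2`**: for every `0 ≤ r ≤ 2`,
`I_{(1,1,r)} = (2π)⁻³ ∫_{[-π,π]³} {cos p₁ + cos p₂ + r cos p₃}₊ √(2/((2+r)E^{(1,1,r)}_p)) dp < √2/2`.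
This is the single hypothesis of `xyAniso_longRangeOrder_ground_of_integral` /
`xyAniso_longRangeOrder_thermal_of_integral` at `n = 1` (hard-core bosons / `S = ½`), hence the
layered quantum XY model has long-range order for every interlayer coupling `0 < r ≤ 2`.
[cite: KLS1988PRL, after eq. (8)] [cite: KLS1988JSP, §3] -/
theorem anisoKlsIntegral_layered_lt {r : ℝ} (hr0 : 0 ≤ r) (hr2 : r ≤ 2) :
    anisoKlsIntegral ![(1 : ℝ), 1, r] < Real.sqrt 2 / 2 :=
  (anisoKlsIntegral_layered_le_two hr0 hr2).trans_lt anisoKlsIntegral_two_lt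

/-- **Spin form**: `I_{(1,1,r)} < n√2/2` for every `n ≥ 1` and `0 ≤ r ≤ 2` — the literal
hypothesis `hI` of `xyAniso_longRangeOrder_thermal_of_integral` with `K = (1, 1, r)`.
[cite: KLS1988JSP, §3] -/
theorem anisoKlsIntegral_layered_lt_spin {r : ℝ} (hr0 : 0 ≤ r) (hr2 : r ≤ 2) {n : ℕ} (hn : 1 ≤ n) :
    anisoKlsIntegral ![(1 : ℝ), 1, r] < n * Real.sqrt 2 / 2 := by
  refine (anisoKlsIntegral_layered_lt hr0 hr2).trans_le ?_
  have hn1 : (1 : ℝ) ≤ n := by exact_mod_cast hn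
  have hs : 0 ≤ Real.sqrt 2 := Real.sqrt_nonneg 2
  nlinarith

end Layered

end Literature.MathematicalPhysics.QuantumLattice
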